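import Literature.AlgebraicGeometry.Modules.CechComplexOpenRestrict
import Literature.AlgebraicGeometry.Modules.SheafHomFunctor
import Literature.Algebra.Homology.HOneMkQOfQuasiIso
import HarnessLib

/-!
# Transport of the module Čech complex along an open immersion and along an isomorphism of schemes

Layer `Literature/AlgebraicGeometry/Modules`, namespace `Literature.AlgebraicGeometry.Modules`.  THEOREMS ONLY (no definition, no instance,
no notation, no named fact, no `sorry`).  Cell `hodgecm-mathlib` (D-0151), P6 «MOD programme», junction (J10-iii-c) of the «H1-DIM-ANY-CHAR cut»
(`dim_K H¹(A, 𝒪_A) = dim A` for an abelian variety in any characteristic, [MumfordAV1970] §13 Cor. 2): the Čech complex of the Poincaré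
bundle restricted to the fibre `A × {0̂} ≅ A` has to be read on `A` itself, i.e. the module Čech complex has to be moved along an ISOMORPHISM of
schemes.  This file is the generalisation of ★ `Modules/CechComplexOpenRestrict` (the case of the inclusion `O.ι : O → Z` of an open
subscheme) to an ARBITRARY open immersion `f : X → Z`, and its specialisation to an isomorphism `f` (an isomorphism is an open immersion with
`f(X) = Z`).  HC_CM is proved only modulo the printed citations until rung 0 closes; nothing here is about HC (count-neutral capital).

THE MATHEMATICS ([GortzWedhorn2023] Def. 21.68 (ordered Čech complex of a family of opens with values in an `𝒪`-module); [Hartshorne1977]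
II §5 p. 110 and III Lemma 4.1 ∕ proof of Prop. 8.1 (restriction of a module to an open and its Čech complex); [StacksProject] Tag 01FG, Tag 02N6).
Let `f : X → Z` be an open immersion with image the open `f(X) = f.opensRange ⊆ Z`, `G` an `𝒪_Z`-module, `𝓦 = (W_j)_{j ∈ κ}` a linearly ordered
family of opens of `Z`, `ρ : A → Γ(Z, 𝒪_Z)` a ring of scalars.  For every open `V ⊆ X`, `Γ(f^*G, V) = Γ(G|_X, V) = Γ(G, f(V))` (Mathlib's
`Scheme.Modules.restrictFunctor f`, for which this is a DEFINITIONAL equality, and `restrictFunctorIsoPullback f : restrictFunctor f ≅ pullback f`),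
the `A`-module structures through `ρ` and `f^♯ ∘ ρ` agree (§2: `(f.appIso V)⁻¹ (ρ(a)|_V) = ρ(a)|_{f(V)}`), and for a NON-EMPTY finite `t ⊆ κ`,
`f(⋂_{j∈t} f⁻¹W_j) = f(X) ∩ ⋂_{j∈t} W_j = ⋂_{j∈t} (f(X) ∩ W_j)` (§1).  These identifications commute with the restriction maps, so they
assemble (★ `OrderedCech.sysComplexIsoNE`, which only reads non-empty simplices) to an isomorphism of cochain complexes of `A`-modules
`Č((f(X) ∩ W_j)_j, G; ρ) ≅ Č((f⁻¹W_j)_j, G|_X; f^♯∘ρ) ≅ Č((f⁻¹W_j)_j, f^*G; f^♯∘ρ)` (§3).  When `f` is an ISOMORPHISM, `f(X) = Z` (Mathlib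
`Scheme.Hom.opensRange_of_isIso`), so the left-hand side is `Č((W_j)_j, G; ρ)` itself (§5); for the structure sheaf `G = 𝒪_Z` one has moreover
`𝒪_Z|_X = 𝒪_X` (Mathlib `Scheme.Modules.restrictUnitIso`), giving `Č((W_j)_j, 𝒪_Z; ρ) ≅ Č((f⁻¹W_j)_j, 𝒪_X; f^♯∘ρ)` (§5).  Consequences: equal
exactness in every degree for ANY rings of scalars on the two sides (★ `exactAt_cechComplex_iff_of_scalars`) (§4, §6), and `A`-linear
isomorphisms ∕ equal `finrank` of the cohomology modules `Ȟ^b = ker d^b ∕ im d^{b-1}` in the map-`mkQ` spelling of the H1-DIM bricks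
(★ `nonempty_HmkQ_linearEquiv_of_quasiIsoAt`) (§6).

MAIN STATEMENTS.  §3 `nonempty_cechComplex_opensRange_inf_iso_cechComplex_preimage (f) [IsOpenImmersion f]` :
`Nonempty (cechComplex (fun j => f.opensRange ⊓ 𝓦 j) G ρ ≅ cechComplex (fun j => f ⁻¹ᵁ 𝓦 j) ((Scheme.Modules.pullback f).obj G) (f.appTop.hom.comp ρ))`;
§5 **`nonempty_cechComplex_iso_cechComplex_preimage_of_isIso (f) [IsIso f]`** :
`Nonempty (cechComplex 𝓦 G ρ ≅ cechComplex (fun j => f ⁻¹ᵁ 𝓦 j) ((Scheme.Modules.pullback f).obj G) (f.appTop.hom.comp ρ))`;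
§5 **`nonempty_cechComplex_unitModule_iso_of_isIso (f) [IsIso f]`** :
`Nonempty (cechComplex 𝓦 (unitModule Z) ρ ≅ cechComplex (fun j => f ⁻¹ᵁ 𝓦 j) (unitModule X) (f.appTop.hom.comp ρ))`;
§6 `exactAt_cechComplex_preimage_iff_of_isIso`, `finrank_HmkQ_cechComplex_preimage_eq_of_isIso`, `finrank_HmkQ_cechComplex_unitModule_preimage_eq_of_isIso`.

## References
* [GortzWedhorn2023] U. Görtz, T. Wedhorn, *Algebraic Geometry II: Cohomology of Schemes* (2023), Def. 21.64, Def. 21.68 (pp. 179–180).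
* [Hartshorne1977] R. Hartshorne, *Algebraic Geometry* (1977), II §5 (p. 110); III Lemma 4.1 (p. 218), proof of Prop. 8.1 (p. 250).
* [StacksProject] The Stacks Project, Tag 01FG (Čech complex and restriction), Tag 02N6, Tag 0111 (quasi-isomorphisms).
* [MumfordAV1970] D. Mumford, *Abelian Varieties* (1970), §13 Cor. 2 (p. 129) (the consumer).
-/

set_option backward.isDefEq.respectTransparency false -- `Scheme.Modules` is not reducible (as in ★ `CechComplexOpenRestrict`)
set_option autoImplicit false

noncomputable section

universe u

open CategoryTheory CategoryTheory.Limits AlgebraicGeometry TopologicalSpace HomologicalComplex Opposite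
open Literature.Algebra.Homology Literature.Algebra.Homology.OrderedCech

namespace Literature.AlgebraicGeometry.Modules

section OpenImmersion

variable {X Z : Scheme.{u}} (f : X ⟶ Z) [IsOpenImmersion f] {κ : Type} [LinearOrder κ] (𝓦 : κ → Z.Opens) (G : Z.Modules)
  {A : Type u} [CommRing A] (ρ : A →+* Γ(Z, ⊤))

/-! ## §1 The opens: `f(f⁻¹W) = f(X) ∩ W` and `f(⋂ f⁻¹W_j) = ⋂ (f(X) ∩ W_j)` on non-empty simplices -/

omit [LinearOrder κ] in
/-- On a NON-EMPTY simplex `t`: `f ''ᵁ ⋂_{j ∈ t} f⁻¹W_j = ⋂_{j ∈ t} (f(X) ⊓ W_j)` (for `t = ∅` the left side is `f(X)`, the right side `Z`);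
Mathlib `Scheme.Hom.image_preimage_eq_opensRange_inf`, ★ `preimage_cechOpen`, ★ `cechOpen_inf_left`. [cite: GortzWedhorn2023, Def. 21.64 (p. 179)] -/
theorem image_cechOpen_preimage_eq (t : Finset κ) (ht : t.Nonempty) :
    f ''ᵁ cechOpen (fun j => f ⁻¹ᵁ 𝓦 j) t = cechOpen (fun j => f.opensRange ⊓ 𝓦 j) t := by
  rw [← preimage_cechOpen, Scheme.Hom.image_preimage_eq_opensRange_inf, cechOpen_inf_left _ _ _ ht]

/-! ## §2 The scalars: `ρ` through `f^♯` on `Γ(X, V)` is `ρ` on `Γ(Z, f(V))` -/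

/-- **The two `A`-module structures agree**: under Mathlib's ring identification `(f.appIso V)⁻¹ : Γ(X, V) ≅ Γ(Z, f ''ᵁ V)` the scalar
`ρ(a)|_V` computed on `X` through `f^♯ ∘ ρ` goes to the scalar `ρ(a)|_{f(V)}` computed on `Z` (★ `toSections`; Mathlib `appLE_appIso_inv`).
[cite: Hartshorne1977, II §5 (p. 110)] [cite: StacksProject, Tag 02N6] -/
theorem appIso_inv_toSections_comp_appTop (V : X.Opens) (a : A) :
    (f.appIso V).inv (toSections (f.appTop.hom.comp ρ) V a) = toSections ρ (f ''ᵁ V) a := by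
  change (f.appLE ⊤ V le_top ≫ (f.appIso V).inv) (ρ a) = _
  rw [Scheme.Hom.appLE_appIso_inv]
  rfl

/-- **`Γ(G|_X, V) = Γ(G, f(V))` as `A`-modules, read on an open `U = f(V)` of `Z`**: there is an `A`-linear isomorphism
`SecMod G ρ U ≃ₗ[A] SecMod (G.restrict f) (f^♯ ∘ ρ) V` which on underlying sections is the restriction of `G` along `f(V) ≤ U` (an equality)
— Mathlib's definitional `Γ(G.restrict f, V) = Γ(G, f ''ᵁ V)` (`restrict_obj`) with the scalars matched by `appIso_inv_toSections_comp_appTop`.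
[cite: Hartshorne1977, II §5 (p. 110)] [cite: GortzWedhorn2023, Def. 21.68 (p. 180)] -/
theorem exists_linearEquiv_secMod_restrict_of_image_eq (U : Z.Opens) (V : X.Opens) (hUV : f ''ᵁ V = U) :
    ∃ e : SecMod G ρ U ≃ₗ[A] SecMod (G.restrict f) (f.appTop.hom.comp ρ) V,
      ∀ x, SecMod.val (e x) = (show Γ(G.restrict f, V) from G.presheaf.map (homOfLE hUV.le).op (SecMod.val x)) := by
  -- forward: restrict along `f(V) ≤ U`; backward: along `U ≤ f(V)`
  let fwd : SecMod G ρ U →ₗ[A] SecMod (G.restrict f) (f.appTop.hom.comp ρ) V :=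
    { toFun := fun x => SecMod.mk (ρ := f.appTop.hom.comp ρ)
        (show Γ(G.restrict f, V) from (G.presheaf.map (homOfLE hUV.le).op (SecMod.val x) : Γ(G, f ''ᵁ V)))
      map_add' := fun x y => by
        apply SecMod.val_injective
        change G.presheaf.map (homOfLE hUV.le).op (SecMod.val x + SecMod.val y) = _
        rw [map_add]
        rfl
      map_smul' := fun a x => by
        apply SecMod.val_injective
        change G.presheaf.map (homOfLE hUV.le).op (toSections ρ U a • SecMod.val x) =
          (f.appIso V).inv (toSections (f.appTop.hom.comp ρ) V a) • G.presheaf.map (homOfLE hUV.le).op (SecMod.val x)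
        rw [Scheme.Modules.map_smul, resO_toSections, appIso_inv_toSections_comp_appTop] }
  let bwd : SecMod (G.restrict f) (f.appTop.hom.comp ρ) V →ₗ[A] SecMod G ρ U :=
    { toFun := fun y => SecMod.mk (ρ := ρ) (G.presheaf.map (homOfLE hUV.ge).op
        (show Γ(G, f ''ᵁ V) from SecMod.val (L := G.restrict f) (ρ := f.appTop.hom.comp ρ) y))
      map_add' := fun x y => by
        apply SecMod.val_injective
        change G.presheaf.map (homOfLE hUV.ge).op
            ((show Γ(G, f ''ᵁ V) from SecMod.val (L := G.restrict f) (ρ := f.appTop.hom.comp ρ) x) +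
              (show Γ(G, f ''ᵁ V) from SecMod.val (L := G.restrict f) (ρ := f.appTop.hom.comp ρ) y)) = _
        rw [map_add]
        rfl
      map_smul' := fun a y => by
        apply SecMod.val_injective
        change G.presheaf.map (homOfLE hUV.ge).op
            ((f.appIso V).inv (toSections (f.appTop.hom.comp ρ) V a) •
              (show Γ(G, f ''ᵁ V) from SecMod.val (L := G.restrict f) (ρ := f.appTop.hom.comp ρ) y)) =
          toSections ρ U a • G.presheaf.map (homOfLE hUV.ge).op
            (show Γ(G, f ''ᵁ V) from SecMod.val (L := G.restrict f) (ρ := f.appTop.hom.comp ρ) y)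
        rw [Scheme.Modules.map_smul, appIso_inv_toSections_comp_appTop, resO_toSections] }
  have hfb : ∀ y, fwd (bwd y) = y := fun y => by
    apply SecMod.val_injective
    change (G.presheaf.map (homOfLE hUV.ge).op ≫ G.presheaf.map (homOfLE hUV.le).op)
        (show Γ(G, f ''ᵁ V) from SecMod.val (L := G.restrict f) (ρ := f.appTop.hom.comp ρ) y) =
      (show Γ(G, f ''ᵁ V) from SecMod.val (L := G.restrict f) (ρ := f.appTop.hom.comp ρ) y)
    rw [← Functor.map_comp, ← op_comp, show homOfLE hUV.le ≫ homOfLE hUV.ge = 𝟙 _ from Subsingleton.elim _ _, op_id,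
      G.presheaf.map_id]
    rfl
  have hbf : ∀ x, bwd (fwd x) = x := fun x => by
    apply SecMod.val_injective
    change (G.presheaf.map (homOfLE hUV.le).op ≫ G.presheaf.map (homOfLE hUV.ge).op) (SecMod.val x) = SecMod.val x
    rw [← Functor.map_comp, ← op_comp, show homOfLE hUV.ge ≫ homOfLE hUV.le = 𝟙 _ from Subsingleton.elim _ _, op_id,
      G.presheaf.map_id]
    rfl
  exact ⟨LinearEquiv.ofLinear fwd bwd (LinearMap.ext hfb) (LinearMap.ext hbf), fun x => rfl⟩

/-! ## §3 The isomorphism of Čech complexes along an open immersion -/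

/-- **`Č((f(X) ∩ W_j)_j, G; ρ) ≅ Č((f⁻¹W_j)_j, G|_X; f^♯∘ρ)`** for Mathlib's restriction `G|_X = G.restrict f` along the open immersion `f`
(termwise §2 on the non-empty simplices, natural under restriction since both sides restrict sections of `G`; ★ `OrderedCech.sysComplexIsoNE`).
[cite: GortzWedhorn2023, Def. 21.68 (p. 180)] [cite: Hartshorne1977, III Lemma 4.1 (p. 218)] -/
theorem nonempty_cechComplex_opensRange_inf_iso_cechComplex_preimage_restrict :
    Nonempty (cechComplex (fun j => f.opensRange ⊓ 𝓦 j) G ρ ≅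
      cechComplex (fun j => f ⁻¹ᵁ 𝓦 j) (G.restrict f) (f.appTop.hom.comp ρ)) := by
  choose e he using fun t : {t : Finset κ // t.Nonempty} =>
    exists_linearEquiv_secMod_restrict_of_image_eq f G ρ (cechOpen (fun j => f.opensRange ⊓ 𝓦 j) t.1)
      (cechOpen (fun j => f ⁻¹ᵁ 𝓦 j) t.1) (image_cechOpen_preimage_eq f 𝓦 t.1 t.2)
  refine ⟨sysComplexIsoNE (M := sectionsSystem (fun j => f.opensRange ⊓ 𝓦 j) G ρ)
    (M' := sectionsSystem (fun j => f ⁻¹ᵁ 𝓦 j) (G.restrict f) (f.appTop.hom.comp ρ))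
    (fun t ht => e ⟨t, ht⟩) fun s t hs ht h x => ?_⟩
  apply SecMod.val_injective (L := G.restrict f) (ρ := f.appTop.hom.comp ρ)
  change SecMod.val (L := G.restrict f) (ρ := f.appTop.hom.comp ρ) (e ⟨t, ht⟩ (SecMod.res G ρ (cechOpen_anti _ h) x)) =
    (G.restrict f).presheaf.map (homOfLE (cechOpen_anti (fun j => f ⁻¹ᵁ 𝓦 j) h)).op
      (SecMod.val (L := G.restrict f) (ρ := f.appTop.hom.comp ρ) (e ⟨s, hs⟩ x))
  rw [he, he, Scheme.Modules.restrict_map, SecMod.val_res]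
  change (G.presheaf.map _ ≫ G.presheaf.map _) (SecMod.val (L := G) (ρ := ρ) x) =
    (G.presheaf.map _ ≫ G.presheaf.map _) (SecMod.val (L := G) (ρ := ρ) x)
  rw [← Functor.map_comp, ← Functor.map_comp]
  rfl

/-- **`Č((f(X) ∩ W_j)_j, G; ρ) ≅ Č((f⁻¹W_j)_j, f^*G; f^♯∘ρ)`** along an open immersion `f : X → Z`: the previous isomorphism followed by
★ `sectionsSystemIsoOfIso` along Mathlib's `restrictFunctorIsoPullback f : restrictFunctor f ≅ pullback f` at `G` (★ `CechComplexOpenRestrict`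
is the case `f = O.ι`). [cite: GortzWedhorn2023, Def. 21.68 (p. 180)] [cite: Hartshorne1977, III Lemma 4.1 (p. 218) and proof of Prop. 8.1 (p. 250)]
[cite: StacksProject, Tag 01FG] -/
theorem nonempty_cechComplex_opensRange_inf_iso_cechComplex_preimage :
    Nonempty (cechComplex (fun j => f.opensRange ⊓ 𝓦 j) G ρ ≅
      cechComplex (fun j => f ⁻¹ᵁ 𝓦 j) ((Scheme.Modules.pullback f).obj G) (f.appTop.hom.comp ρ)) := by
  obtain ⟨e⟩ := nonempty_cechComplex_opensRange_inf_iso_cechComplex_preimage_restrict f 𝓦 G ρ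
  exact ⟨e ≪≫ sectionsSystemIsoOfIso (fun j => f ⁻¹ᵁ 𝓦 j) ((Scheme.Modules.restrictFunctorIsoPullback f).app G)
    (f.appTop.hom.comp ρ)⟩

/-- **Structure-sheaf form `Č((f(X) ∩ W_j)_j, 𝒪_Z; ρ) ≅ Č((f⁻¹W_j)_j, 𝒪_X; f^♯∘ρ)`** along an open immersion `f : X → Z`
(`𝒪_Z|_X = 𝒪_X`: Mathlib `Scheme.Modules.restrictUnitIso f`, then ★ `sectionsSystemIsoOfIso`). [cite: GortzWedhorn2023, Def. 21.68 (p. 180)]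
[cite: Hartshorne1977, III Lemma 4.1 (p. 218)] -/
theorem nonempty_cechComplex_unitModule_opensRange_inf_iso_preimage :
    Nonempty (cechComplex (fun j => f.opensRange ⊓ 𝓦 j) (unitModule Z) ρ ≅
      cechComplex (fun j => f ⁻¹ᵁ 𝓦 j) (unitModule X) (f.appTop.hom.comp ρ)) := by
  obtain ⟨e⟩ := nonempty_cechComplex_opensRange_inf_iso_cechComplex_preimage_restrict f 𝓦 (unitModule Z) ρ
  exact ⟨e ≪≫ sectionsSystemIsoOfIso (fun j => f ⁻¹ᵁ 𝓦 j) (Scheme.Modules.restrictUnitIso f) (f.appTop.hom.comp ρ)⟩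

/-! ## §4 Exactness transfers along an open immersion, with free scalars on the source -/

/-- **Exactness of `Č((f⁻¹W_j)_j, f^*G)` in degree `n` ⇔ exactness of `Č((f(X) ∩ W_j)_j, G)` in degree `n`**, for ANY ring of scalars `ρ″`
on `X` (★ `exactAt_cechComplex_iff_of_scalars`: exactness does not see the scalars). [cite: GortzWedhorn2023, Def. 21.68 (p. 180)]
[cite: StacksProject, Tag 01FG] -/
theorem exactAt_cechComplex_preimage_iff_opensRange_inf {A'' : Type u} [CommRing A''] (ρ'' : A'' →+* Γ(X, ⊤)) (n : ℤ) :
    (cechComplex (fun j => f ⁻¹ᵁ 𝓦 j) ((Scheme.Modules.pullback f).obj G) ρ'').ExactAt n ↔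
      (cechComplex (fun j => f.opensRange ⊓ 𝓦 j) G ρ).ExactAt n := by
  obtain ⟨e⟩ := nonempty_cechComplex_opensRange_inf_iso_cechComplex_preimage f 𝓦 G ρ
  rw [exactAt_cechComplex_iff_of_scalars (fun j => f ⁻¹ᵁ 𝓦 j) ((Scheme.Modules.pullback f).obj G) ρ''
    (f.appTop.hom.comp ρ) n]
  exact (exactAt_iff_of_quasiIsoAt e.hom n).symm

end OpenImmersion

/-! ## §5 Along an isomorphism of schemes: the cover itself -/

section Iso

variable {X Z : Scheme.{u}} (f : X ⟶ Z) [IsIso f] {κ : Type} [LinearOrder κ] (𝓦 : κ → Z.Opens) (G : Z.Modules)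
  {A : Type u} [CommRing A] (ρ : A →+* Γ(Z, ⊤))

omit [LinearOrder κ] in
/-- For an isomorphism `f`, `f(X) ∩ W_j = W_j` for all `j` (Mathlib `Scheme.Hom.opensRange_of_isIso`). [cite: GortzWedhorn2023, Def. 21.64 (p. 179)] -/
theorem opensRange_inf_eq_of_isIso : (fun j => f.opensRange ⊓ 𝓦 j) = 𝓦 :=
  funext fun j => by rw [Scheme.Hom.opensRange_of_isIso, top_inf_eq]

/-- **`Č((W_j)_j, G; ρ) ≅ Č((f⁻¹W_j)_j, G|_X; f^♯∘ρ)` along an ISOMORPHISM `f : X → Z`** (restriction form; §3 with `f(X) = Z`).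
[cite: GortzWedhorn2023, Def. 21.68 (p. 180)] [cite: Hartshorne1977, III Lemma 4.1 (p. 218)] -/
theorem nonempty_cechComplex_iso_cechComplex_preimage_restrict_of_isIso :
    Nonempty (cechComplex 𝓦 G ρ ≅ cechComplex (fun j => f ⁻¹ᵁ 𝓦 j) (G.restrict f) (f.appTop.hom.comp ρ)) := by
  obtain ⟨e⟩ := nonempty_cechComplex_opensRange_inf_iso_cechComplex_preimage_restrict f 𝓦 G ρ
  exact ⟨eqToIso (congrArg (fun 𝓥 : κ → Z.Opens => cechComplex 𝓥 G ρ) (opensRange_inf_eq_of_isIso f 𝓦)).symm ≪≫ e⟩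

/-- **`Č((W_j)_j, G; ρ) ≅ Č((f⁻¹W_j)_j, f^*G; f^♯∘ρ)` along an ISOMORPHISM of schemes `f : X → Z`** — the module Čech complex of `G` with
respect to a family of opens of `Z` IS the module Čech complex of the pulled-back module with respect to the pulled-back family (§3 with
`f(X) = Z`). [cite: GortzWedhorn2023, Def. 21.68 (p. 180)] [cite: Hartshorne1977, III Lemma 4.1 (p. 218)] [cite: StacksProject, Tag 01FG] -/
theorem nonempty_cechComplex_iso_cechComplex_preimage_of_isIso :
    Nonempty (cechComplex 𝓦 G ρ ≅ cechComplex (fun j => f ⁻¹ᵁ 𝓦 j) ((Scheme.Modules.pullback f).obj G) (f.appTop.hom.comp ρ)) := by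
  obtain ⟨e⟩ := nonempty_cechComplex_opensRange_inf_iso_cechComplex_preimage f 𝓦 G ρ
  exact ⟨eqToIso (congrArg (fun 𝓥 : κ → Z.Opens => cechComplex 𝓥 G ρ) (opensRange_inf_eq_of_isIso f 𝓦)).symm ≪≫ e⟩

/-- **Structure-sheaf form `Č((W_j)_j, 𝒪_Z; ρ) ≅ Č((f⁻¹W_j)_j, 𝒪_X; f^♯∘ρ)` along an ISOMORPHISM `f : X → Z`** — the currency of the
H1-DIM head (`Č(𝓤, 𝒪_A)` on the abelian variety versus `Č(pr⁻¹𝓤, 𝒪)` on `A × {0̂}`); Mathlib `Scheme.Modules.restrictUnitIso f`.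
[cite: GortzWedhorn2023, Def. 21.68 (p. 180)] [cite: Hartshorne1977, III Lemma 4.1 (p. 218)] -/
theorem nonempty_cechComplex_unitModule_iso_of_isIso :
    Nonempty (cechComplex 𝓦 (unitModule Z) ρ ≅ cechComplex (fun j => f ⁻¹ᵁ 𝓦 j) (unitModule X) (f.appTop.hom.comp ρ)) := by
  obtain ⟨e⟩ := nonempty_cechComplex_unitModule_opensRange_inf_iso_preimage f 𝓦 ρ
  exact ⟨eqToIso (congrArg (fun 𝓥 : κ → Z.Opens => cechComplex 𝓥 (unitModule Z) ρ) (opensRange_inf_eq_of_isIso f 𝓦)).symm ≪≫ e⟩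

/-! ## §6 Exactness and cohomology counts along an isomorphism of schemes -/

/-- **Exactness of `Č((f⁻¹W_j)_j, f^*G)` in degree `n` ⇔ exactness of `Č((W_j)_j, G)` in degree `n`** along an isomorphism `f`, for ANY ring
of scalars `ρ″` on `X`. [cite: GortzWedhorn2023, Def. 21.68 (p. 180)] [cite: StacksProject, Tag 01FG] -/
theorem exactAt_cechComplex_preimage_iff_of_isIso {A'' : Type u} [CommRing A''] (ρ'' : A'' →+* Γ(X, ⊤)) (n : ℤ) :
    (cechComplex (fun j => f ⁻¹ᵁ 𝓦 j) ((Scheme.Modules.pullback f).obj G) ρ'').ExactAt n ↔ (cechComplex 𝓦 G ρ).ExactAt n := by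
  rw [exactAt_cechComplex_preimage_iff_opensRange_inf f 𝓦 G ρ ρ'' n, opensRange_inf_eq_of_isIso f 𝓦]

/-- **Exactness of `Č((f⁻¹W_j)_j, 𝒪_X)` in degree `n` ⇔ exactness of `Č((W_j)_j, 𝒪_Z)` in degree `n`** along an isomorphism `f`, for ANY ring
of scalars `ρ″` on `X` (structure-sheaf form). [cite: GortzWedhorn2023, Def. 21.68 (p. 180)] [cite: StacksProject, Tag 01FG] -/
theorem exactAt_cechComplex_unitModule_preimage_iff_of_isIso {A'' : Type u} [CommRing A''] (ρ'' : A'' →+* Γ(X, ⊤)) (n : ℤ) :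
    (cechComplex (fun j => f ⁻¹ᵁ 𝓦 j) (unitModule X) ρ'').ExactAt n ↔ (cechComplex 𝓦 (unitModule Z) ρ).ExactAt n := by
  obtain ⟨e⟩ := nonempty_cechComplex_unitModule_iso_of_isIso f 𝓦 ρ
  rw [exactAt_cechComplex_iff_of_scalars (fun j => f ⁻¹ᵁ 𝓦 j) (unitModule X) ρ'' (f.appTop.hom.comp ρ) n]
  exact (exactAt_iff_of_quasiIsoAt e.hom n).symm

/-- **`Ȟ^b((W_j)_j, G) ≃ₗ[A] Ȟ^b((f⁻¹W_j)_j, f^*G)` along an isomorphism `f`**, in the map-`mkQ` spelling `↥((ker d^{b,c}).map (range d^{a,b}).mkQ)`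
of the H1-DIM bricks (`a + 1 = b`, `b + 1 = c`; ★ `nonempty_HmkQ_linearEquiv_of_quasiIsoAt` on the isomorphism of §5).
[cite: StacksProject, Tag 0111] [cite: GortzWedhorn2023, Def. 21.68 (p. 180)] -/
theorem nonempty_HmkQ_cechComplex_linearEquiv_preimage_of_isIso (a b c : ℤ) (hab : a + 1 = b) (hbc : b + 1 = c) :
    Nonempty (↥((LinearMap.ker ((cechComplex 𝓦 G ρ).d b c).hom).map (LinearMap.range ((cechComplex 𝓦 G ρ).d a b).hom).mkQ) ≃ₗ[A]
      ↥((LinearMap.ker ((cechComplex (fun j => f ⁻¹ᵁ 𝓦 j) ((Scheme.Modules.pullback f).obj G) (f.appTop.hom.comp ρ)).d b c).hom).map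
        (LinearMap.range ((cechComplex (fun j => f ⁻¹ᵁ 𝓦 j) ((Scheme.Modules.pullback f).obj G) (f.appTop.hom.comp ρ)).d a b).hom).mkQ)) := by
  obtain ⟨e⟩ := nonempty_cechComplex_iso_cechComplex_preimage_of_isIso f 𝓦 G ρ
  exact nonempty_HmkQ_linearEquiv_of_quasiIsoAt e.hom a b c hab hbc

/-- **Equal `finrank_A` of `Ȟ^b((W_j)_j, G)` and `Ȟ^b((f⁻¹W_j)_j, f^*G)` along an isomorphism `f`** (map-`mkQ` spelling; `a + 1 = b`, `b + 1 = c`).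
[cite: StacksProject, Tag 0111] [cite: GortzWedhorn2023, Def. 21.68 (p. 180)] -/
theorem finrank_HmkQ_cechComplex_preimage_eq_of_isIso (a b c : ℤ) (hab : a + 1 = b) (hbc : b + 1 = c) :
    Module.finrank A ↥((LinearMap.ker ((cechComplex (fun j => f ⁻¹ᵁ 𝓦 j) ((Scheme.Modules.pullback f).obj G) (f.appTop.hom.comp ρ)).d b c).hom).map
        (LinearMap.range ((cechComplex (fun j => f ⁻¹ᵁ 𝓦 j) ((Scheme.Modules.pullback f).obj G) (f.appTop.hom.comp ρ)).d a b).hom).mkQ) =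
      Module.finrank A ↥((LinearMap.ker ((cechComplex 𝓦 G ρ).d b c).hom).map (LinearMap.range ((cechComplex 𝓦 G ρ).d a b).hom).mkQ) := by
  obtain ⟨e⟩ := nonempty_HmkQ_cechComplex_linearEquiv_preimage_of_isIso f 𝓦 G ρ a b c hab hbc
  exact e.finrank_eq.symm

/-- **`Ȟ^b((W_j)_j, 𝒪_Z) ≃ₗ[A] Ȟ^b((f⁻¹W_j)_j, 𝒪_X)` along an isomorphism `f`** (structure-sheaf form, map-`mkQ` spelling; `a + 1 = b`, `b + 1 = c`).
[cite: StacksProject, Tag 0111] [cite: GortzWedhorn2023, Def. 21.68 (p. 180)] -/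
theorem nonempty_HmkQ_cechComplex_unitModule_linearEquiv_preimage_of_isIso (a b c : ℤ) (hab : a + 1 = b) (hbc : b + 1 = c) :
    Nonempty (↥((LinearMap.ker ((cechComplex 𝓦 (unitModule Z) ρ).d b c).hom).map
        (LinearMap.range ((cechComplex 𝓦 (unitModule Z) ρ).d a b).hom).mkQ) ≃ₗ[A]
      ↥((LinearMap.ker ((cechComplex (fun j => f ⁻¹ᵁ 𝓦 j) (unitModule X) (f.appTop.hom.comp ρ)).d b c).hom).map
        (LinearMap.range ((cechComplex (fun j => f ⁻¹ᵁ 𝓦 j) (unitModule X) (f.appTop.hom.comp ρ)).d a b).hom).mkQ)) := by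
  obtain ⟨e⟩ := nonempty_cechComplex_unitModule_iso_of_isIso f 𝓦 ρ
  exact nonempty_HmkQ_linearEquiv_of_quasiIsoAt e.hom a b c hab hbc

/-- **Equal `finrank_A` of `Ȟ^b((W_j)_j, 𝒪_Z)` and `Ȟ^b((f⁻¹W_j)_j, 𝒪_X)` along an isomorphism `f`** (structure-sheaf form, map-`mkQ`
spelling; `a + 1 = b`, `b + 1 = c`) — the number the H1-DIM head moves from `A × {0̂}` to `A`. [cite: StacksProject, Tag 0111]
[cite: GortzWedhorn2023, Def. 21.68 (p. 180)] [cite: MumfordAV1970, §13 Cor. 2 (p. 129)] -/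
theorem finrank_HmkQ_cechComplex_unitModule_preimage_eq_of_isIso (a b c : ℤ) (hab : a + 1 = b) (hbc : b + 1 = c) :
    Module.finrank A ↥((LinearMap.ker ((cechComplex (fun j => f ⁻¹ᵁ 𝓦 j) (unitModule X) (f.appTop.hom.comp ρ)).d b c).hom).map
        (LinearMap.range ((cechComplex (fun j => f ⁻¹ᵁ 𝓦 j) (unitModule X) (f.appTop.hom.comp ρ)).d a b).hom).mkQ) =
      Module.finrank A ↥((LinearMap.ker ((cechComplex 𝓦 (unitModule Z) ρ).d b c).hom).map
        (LinearMap.range ((cechComplex 𝓦 (unitModule Z) ρ).d a b).hom).mkQ) := by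
  obtain ⟨e⟩ := nonempty_HmkQ_cechComplex_unitModule_linearEquiv_preimage_of_isIso f 𝓦 ρ a b c hab hbc
  exact e.finrank_eq.symm

end Iso

end Literature.AlgebraicGeometry.Modules

end
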